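import Summits.Ventures.PercRepro.Night2OneFatCaseOneAssemblyD

/-!
# PercRepro — the case-1 assembly, part E: the load of one source (night-2, gen 29)

The per-source bound of §4⁗ H: at a source `y₁` of the one-coloop target `S` (coloops of `(S ∖ y₁) ∖ K` equal to
`{w, y₂, y₃}`), the good-source load `gtLoadAt (S ∖ y₁) y₁` is at most `max (r_H + r₂ + r₃ − 11/18) 0 / g` for any
`g ≤ |gtPts (S ∖ y₁)|`, where `r_H` is the request of the face at `w` and `r₂, r₃` are the face requests of the two
other faces (`faceReq (insert y_b P)`); and two fat closures coincide when there is at most one.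
-/

namespace PercRepro.Shadow

open Finset PerFlat ThmH

variable {α : Type*} [DecidableEq α] {M : Matroid α} [M.Finite] {G : Finset α}

section SourceLoad

/-- With at most one fat closure, any two fat closures coincide. -/
theorem eq_of_mem_fatClosures_of_card_le_one (hfat : (fatClosures M 5 G 2).card ≤ 1) {A B : Finset α}
    (hA : A ∈ fatClosures M 5 G 2) (hB : B ∈ fatClosures M 5 G 2) : A = B := by
  by_contra hAB
  have hsub : ({A, B} : Finset (Finset α)) ⊆ fatClosures M 5 G 2 := by
    intro C hC
    rw [Finset.mem_insert, Finset.mem_singleton] at hC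
    rcases hC with rfl | rfl
    · exact hA
    · exact hB
  have := Finset.card_le_card hsub
  rw [Finset.card_pair hAB] at this
  omega

open scoped Classical in
/-- **The load of a source.** At a source `y₁` of a one-coloop target `S` (`coloops (S ∖ K) = {w}`) whose erasure has the
coloops `{w, y₂, y₃}`, with the faces `(S ∖ y₁) ∖ y₂ = insert y₃ P`, `(S ∖ y₁) ∖ y₃ = insert y₂ P`, the request `r_H` of
the face at `w` (when thin) and the face requests `r₂, r₃`, the good-source load is at most
`max (r_H + r₂ + r₃ − 11/18) 0 / g` for every `0 < g ≤ |gtPts (S ∖ y₁)|`. -/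
theorem gtLoadAt_le_of_triple (hG : G ∈ flatsQ M (5 + 1)) (hd : (gr M \ G).card = 2) (hk : kColoops M G = 1)
    (hs : ∀ e ∈ gr M, ∀ f ∈ gr M, e ≠ f → rkN M {e, f} = 2) (hl : ∀ e ∈ gr M, M.Indep {e})
    {S : Finset α} (hSG : S ⊆ G) {w : α} (hc : coloops M (S \ coloops M G) = {w}) {y₁ : α} (hy₁ : y₁ ∈ S)
    {w₀ : α} (hw₀ : w₀ ∈ S.erase y₁) (h0 : faceLossP M 5 G (bigP M G) (S.erase y₁) w₀ ≠ 0)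
    {y₂ y₃ : α} (hC : coloops M (S.erase y₁ \ coloops M G) = {w, y₂, y₃}) (h12 : w ≠ y₂) (h13 : w ≠ y₃)
    (h23 : y₂ ≠ y₃) {P : Finset α} (hF₁₂ : (S.erase y₁).erase y₂ = insert y₃ P)
    (hF₁₃ : (S.erase y₁).erase y₃ = insert y₂ P) {rH r₂ r₃ : ℚ}
    (hreqw : (S.erase y₁).erase w ∈ thinMembers M 5 G → req M 5 ((S.erase y₁).erase w) = rH)
    (hr₂ : r₂ = faceReq M G (insert y₂ P)) (hr₃ : r₃ = faceReq M G (insert y₃ P)) {g : ℕ}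
    (hg : g ≤ (gtPts M 5 G (S.erase y₁)).card) (hg0 : 0 < g) :
    gtLoadAt M 5 G (bigP M G) (S.erase y₁) y₁ ≤ max (rH + r₂ + r₃ - 11 / 18) 0 / (g : ℚ) := by
  have hd' : (gr M \ G).card ≤ 5 := by omega
  have hgood := mem_gtPts_of_source_one_coloop hG hd hk hs hl hSG hc hy₁ hw₀ h0
  rw [gtLoadAt_of_mem_gtPts _ hgood]
  obtain ⟨hQG, -, -, -, -, -⟩ := lossy_structure_of_faceLossP_ne_zero hG hd hk hs hl hw₀ h0
  obtain ⟨hthw, hth₂, hth₃⟩ := faces_thin_of_triple hG hd hk hs hl hw₀ h0 hC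
  have hL1 := L1_eq_three hG hd hk hs hl hw₀ h0 hC h12 h13 h23
  rw [hreqw hthw, req_eq_faceReq hG hd hth₂, req_eq_faceReq hG hd hth₃, hF₁₂, hF₁₃, ← hr₃, ← hr₂] at hL1
  have hloss := faceLossP_sum_le_L1_sub hG hd hk hQG
  rw [hL1] at hloss
  have hloss' : ∑ w' ∈ S.erase y₁, faceLossP M 5 G (bigP M G) (S.erase y₁) w' ≤ max (rH + r₂ + r₃ - 11 / 18) 0 :=
    hloss.trans (max_le_max (by linarith) (le_refl _))
  have hnn0 : 0 ≤ ∑ w' ∈ S.erase y₁, faceLossP M 5 G (bigP M G) (S.erase y₁) w' :=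
    Finset.sum_nonneg (fun w' _ => faceLossP_nonneg hG hd' _ w')
  have hgpos : (0 : ℚ) < (g : ℚ) := by exact_mod_cast hg0
  have hgle : (g : ℚ) ≤ ((gtPts M 5 G (S.erase y₁)).card : ℚ) := by exact_mod_cast hg
  calc (∑ w' ∈ S.erase y₁, faceLossP M 5 G (bigP M G) (S.erase y₁) w') / ((gtPts M 5 G (S.erase y₁)).card : ℚ)
      ≤ (∑ w' ∈ S.erase y₁, faceLossP M 5 G (bigP M G) (S.erase y₁) w') / (g : ℚ) :=
        div_le_div_of_nonneg_left hnn0 hgpos hgle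
    _ ≤ _ := div_le_div_of_nonneg_right hloss' hgpos.le

end SourceLoad

end PercRepro.Shadow
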